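/-
Copyright (c) 2026 the pub-hodgecm-mathlib formalisation cell (harness21).  Prover seat hodgecm-mathlib-K2Liu-p10 (g4), Track B «K2-LIT»,
#184♮ = hLiu418 = `stmt-HodgeConjecture-24832`; (σ) endgame organ, SMALL SIDE, S-1 part 1 (the frame letters' engine).  KERNEL: theorems only.
-/
import Summits.HodgeConjecture.HodgeConjecture.Theorems.K2LiuKRFrameDefs   -- ★ S-0a p860515/p860546 (`krFrame`, `krFrameTw`; brings I-0 `reFrame`)
import Literature.NumberTheory.Automorphic.UnitaryGroupSymplecticEmbedding  -- ★ `hermForm`, `hermForm_mulVec`, `IsQuadraticCoordinates.im_hermForm_map`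
import Literature.NumberTheory.Automorphic.QuadraticRestrictionOfScalars     -- ★ `isQuadraticCoordinates_local`, `re`/`im`
import HarnessLib

/-!
# Crux `HLiu418`, (σ) small side, S-1 part 1: THE ADAPTED PAIRING ON THE REAL FRAME IS TWICE THE IMAGINARY PART OF THE HERMITIAN PAIRING
# `β_{deltaGram e₂ T}(R b, R b′) = 2·im h_T(b, b′)` — and is therefore moved by `E ⊗ F_v`-linear frame changes exactly as `h_T` is

Cell `hodgecm-mathlib`, crux item hLiu418 = `stmt-HodgeConjecture-24832`, route of record `HCCMUnconditional`; squad K2 ∕ K2Liu, prover K2Liu-p10 (g4).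
THEOREMS ONLY; lane `--supports stmt-HodgeConjecture-24832 --as helper`.  Generic D10 currency `(F E c hcδ hδ hd v n)` of ★ I-0.

The engine under the frame letter hB of ★ (L2) `exists_krMap_toRep_weyl` (★ `krFun_betaFourier_eq`): for the Δ-adapted Gram `J_Δ = deltaGram e₂ T` (★ β-1 `deltaGramLoc = deltaGram e₂ T₀,v`)
and ★ I-0's real frame `R = reFrame` (`R b = glue e₂ (re ∘ b) (im ∘ b)`):
* §1 **`toLinearMap₂'_deltaGram_reFrame`**: `β_{J_Δ}(R b, R b′) = 2·(β_T(re b, im b′) − β_T(re b′, im b))` (★ `deltaGram_glue`), and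
  **`toLinearMap₂'_deltaGram_reFrame_eq_im_hermForm`**: `… = 2·im h_T(b, b′)` with `h_T = hermForm (c ⊗ 1) (T.map ι_v)` (★ `im_hermForm_map` at ★ `isQuadraticCoordinates_local`), `T` symmetric;
* §2 consequences: `β_{J_Δ}(R (g b), R (g b′)) = β_{J_Δ}(R b, R b′)` for `g` `h_T`-unitary (**`toLinearMap₂'_deltaGram_reFrame_mulVec`**, ★ `hermForm_mulVec`), and the general
  TRANSPORT **`toLinearMap₂'_deltaGram_reFrame_mulVec_of_eq`**: `(gσ)ᵀ·T′·g = T ⇒ β_{J_Δ(T)}(R b, R b′) = β_{J_Δ(T′)}(R (g b), R (g b′))` — the form in which a Witt frame `P` BY VALUE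
  moves the big datum's pairing to the Witt Gram (S-1 part 2: kept block = small datum, killed × integrated = plain dot after the `J_Δᵀ` twist of ★ `krFrameTw`).

HONEST LABEL: HC_CM is proved only modulo the 7 printed citations (2 remaining named inputs: hLiu418 = stmt-HodgeConjecture-24832, h413 = stmt-HodgeConjecture-24833)
until rung 0 closes; helper, closes no item.
References: [Kudla1994] S. Kudla, Israel J. Math. 87 (1994) §2 (the doubled space and `ℓ_Δ`); [GelbartRogawski1991] §3.1 p. 454 (`im h` = the symplectic form);
[MoeglinVignerasWaldspurger1987] Chap. 1 I.17; [KudlaRallis1994] §1.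
-/

set_option autoImplicit false
set_option linter.dupNamespace false -- the mandated namespace repeats `HodgeConjecture.HodgeConjecture`

noncomputable section

open Matrix
open NumberField IsDedekindDomain
open Literature.NumberTheory.Automorphic Literature.NumberTheory.Automorphic.UnitaryGroup
open Literature.NumberTheory.Automorphic.UnitaryGroup.QuadraticCoordinates
open Literature.RepresentationTheory.HeisenbergGroup
open Literature.NumberTheory.GelbartRogawski1991 Literature.NumberTheory.GelbartRogawski1991.AdaptedBlocks
open Literature.NumberTheory.GelbartRogawski1991.UnitaryDualPair.LocalSplitting
open Summit.HodgeConjecture.HodgeConjecture.Cruxes.HLiu418.K2LiuDeltaModelRealFrame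

namespace Summit.HodgeConjecture.HodgeConjecture.Cruxes.HLiu418.K2LiuKRFrameHermitianBridge

variable (F : Type) [Field F] [NumberField F] (E : Type) [Field E] [NumberField E] [Algebra F E]
  [Algebra.IsQuadraticExtension F E] (c : E ≃ₐ[F] E)
  {δ : E} (hcδ : c δ = -δ) (hδ : δ ≠ 0) (v : HeightOneSpectrum (𝓞 F)) (n : ℕ)

/-! ## §1 `β_{J_Δ}` on the real frame -/

/-- **`β_{J_Δ}(R b, R b′) = 2·(β_T(re b, im b′) − β_T(re b′, im b))`** (★ `deltaGram_glue` on ★ I-0's `reFrame`). [cite: Kudla1994, §2] -/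
theorem toLinearMap₂'_deltaGram_reFrame (T : Matrix (Fin n) (Fin n) (v.adicCompletion F)) (b b' : Fin n → LocalRing E v) :
    Matrix.toLinearMap₂' (v.adicCompletion F) (deltaGram (e₂ (n := n)) T) (reFrame F E c hcδ hδ v n b) (reFrame F E c hcδ hδ v n b') =
      2 * (Matrix.toLinearMap₂' (v.adicCompletion F) T (fun i => re (quadraticLocalEquiv E v c hcδ hδ).toLinearEquiv.toAddEquiv (b i))
              (fun i => im (quadraticLocalEquiv E v c hcδ hδ).toLinearEquiv.toAddEquiv (b' i)) -
            Matrix.toLinearMap₂' (v.adicCompletion F) T (fun i => re (quadraticLocalEquiv E v c hcδ hδ).toLinearEquiv.toAddEquiv (b' i))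
              (fun i => im (quadraticLocalEquiv E v c hcδ hδ).toLinearEquiv.toAddEquiv (b i))) := by
  rw [reFrame_apply, reFrame_apply, deltaGram_glue]
  ring

/-- **`β_{J_Δ}(R b, R b′) = 2·im h_T(b, b′)`** for `T` symmetric, `h_T = hermForm (c ⊗ 1) (T.map ι_v)` (conjugate-linear in the first variable).
[cite: GelbartRogawski1991, §3.1 p. 454] [cite: Kudla1994, §2] -/
theorem toLinearMap₂'_deltaGram_reFrame_eq_im_hermForm {d : F} (hd : δ * δ = algebraMap F E d) {T : Matrix (Fin n) (Fin n) (v.adicCompletion F)} (hT : T.IsSymm)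
    (b b' : Fin n → LocalRing E v) :
    Matrix.toLinearMap₂' (v.adicCompletion F) (deltaGram (e₂ (n := n)) T) (reFrame F E c hcδ hδ v n b) (reFrame F E c hcδ hδ v n b') =
      2 * im (quadraticLocalEquiv E v c hcδ hδ).toLinearEquiv.toAddEquiv
        (hermForm ((conjLocal E c v : LocalRing E v →+* LocalRing E v)) (T.map (toLocalRing E v)) b b') := by
  rw [toLinearMap₂'_deltaGram_reFrame,
    (isQuadraticCoordinates_local E v c hcδ hδ hd).im_hermForm_map (Fin n) hT (fun a => by simp)
      (by simp [hcδ]) b b']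
  simp only [alt_apply, polar_apply]
  rfl

/-! ## §2 Transport under `E ⊗ F_v`-linear frame changes -/

/-- `h_T`-unitary `g` preserve `β_{J_Δ}` on the real frame. [cite: MoeglinVignerasWaldspurger1987, Chap. 1 I.17] -/
theorem toLinearMap₂'_deltaGram_reFrame_mulVec {d : F} (hd : δ * δ = algebraMap F E d) {T : Matrix (Fin n) (Fin n) (v.adicCompletion F)} (hT : T.IsSymm)
    {g : Matrix (Fin n) (Fin n) (LocalRing E v)}
    (hg : (g.map (conjLocal E c v))ᵀ * T.map (toLocalRing E v) * g = T.map (toLocalRing E v)) (b b' : Fin n → LocalRing E v) :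
    Matrix.toLinearMap₂' (v.adicCompletion F) (deltaGram (e₂ (n := n)) T) (reFrame F E c hcδ hδ v n (g *ᵥ b)) (reFrame F E c hcδ hδ v n (g *ᵥ b')) =
      Matrix.toLinearMap₂' (v.adicCompletion F) (deltaGram (e₂ (n := n)) T) (reFrame F E c hcδ hδ v n b) (reFrame F E c hcδ hδ v n b') := by
  rw [toLinearMap₂'_deltaGram_reFrame_eq_im_hermForm F E c hcδ hδ v n hd hT, toLinearMap₂'_deltaGram_reFrame_eq_im_hermForm F E c hcδ hδ v n hd hT,
    hermForm_mulVec _ hg]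

/-- **TRANSPORT OF `β_{J_Δ}` ALONG A FRAME BY VALUE**: if `(gσ)ᵀ·T′·g = T` (entrywise in `E ⊗ F_v`) with `T`, `T′` symmetric over `F_v`, then
`β_{J_Δ(T)}(R b, R b′) = β_{J_Δ(T′)}(R (g b), R (g b′))` — a Witt frame `P` of `V′_v` moves the big datum's pairing to the Witt Gram. [cite: KudlaRallis1994, §1]
[cite: MoeglinVignerasWaldspurger1987, Chap. 1 I.17] -/
theorem toLinearMap₂'_deltaGram_reFrame_mulVec_of_eq {d : F} (hd : δ * δ = algebraMap F E d) {T T' : Matrix (Fin n) (Fin n) (v.adicCompletion F)} (hT : T.IsSymm)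
    (hT' : T'.IsSymm)
    {g : Matrix (Fin n) (Fin n) (LocalRing E v)} (hg : (g.map (conjLocal E c v))ᵀ * T'.map (toLocalRing E v) * g = T.map (toLocalRing E v))
    (b b' : Fin n → LocalRing E v) :
    Matrix.toLinearMap₂' (v.adicCompletion F) (deltaGram (e₂ (n := n)) T) (reFrame F E c hcδ hδ v n b) (reFrame F E c hcδ hδ v n b') =
      Matrix.toLinearMap₂' (v.adicCompletion F) (deltaGram (e₂ (n := n)) T') (reFrame F E c hcδ hδ v n (g *ᵥ b)) (reFrame F E c hcδ hδ v n (g *ᵥ b')) := by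
  rw [toLinearMap₂'_deltaGram_reFrame_eq_im_hermForm F E c hcδ hδ v n hd hT, toLinearMap₂'_deltaGram_reFrame_eq_im_hermForm F E c hcδ hδ v n hd hT']
  congr 2
  -- `h_T(b,b′) = h_{T′}(g b, g b′)`
  have h1 : (⇑(conjLocal E c v : LocalRing E v →+* LocalRing E v) ∘ (g *ᵥ b)) = g.map (conjLocal E c v) *ᵥ (⇑(conjLocal E c v : LocalRing E v →+* LocalRing E v) ∘ b) :=
    funext fun i => RingHom.map_mulVec (conjLocal E c v : LocalRing E v →+* LocalRing E v) g b i
  rw [hermForm_apply, hermForm_apply, h1, ← hg, ← Matrix.mulVec_mulVec, ← Matrix.mulVec_mulVec,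
    Matrix.dotProduct_mulVec _ (g.map (conjLocal E c v : LocalRing E v →+* LocalRing E v))ᵀ, Matrix.vecMul_transpose]

end Summit.HodgeConjecture.HodgeConjecture.Cruxes.HLiu418.K2LiuKRFrameHermitianBridge

end
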